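import Literature.MathematicalPhysics.QuantumFieldTheory.WilsonOddRPNegCoords
import Literature.MathematicalPhysics.QuantumFieldTheory.FariaDaVeigaOCarroll2022.FdVOC22MultiReflectionBound
import HarnessLib

/-!
# Crux `NT` (stmt-QuantumFields-19353): reflection-positivity CAUCHY–SCHWARZ for the Wilson measure on ODD tori

Helper file (`--supports stmt-QuantumFields-19353`) of the fleet lead prover of crux `NT` (unit `ym-spine-19353-p1`,
g3).  The two-point clause (i) of `LowerBounds G r a` (Defs `Theorems/LangevinControlUVOSLegsFromFemtoAndGapDefs.lean`)
is a DIAGONAL reflection quantity `Q2(θv, v)` on the odd tori `(ℤ/(2L+1)ℤ)⁴`.  The crux-ideate card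
`rp-linearised-loop-response` (seat `ym-cruxidea-19353-1`, evidence on the item) proposes to feed it by the
Osterwalder–Seiler form used as a Cauchy–Schwarz TRANSFER: a floor on the off-diagonal entry `Cov(W∘ϑ, Ṽ)` (one
bounded spectator `W`) forces a floor on the diagonal entry `Cov(Ṽ∘ϑ, Ṽ)`.  Its first lemma «RPCS» (claimed provable
now) is proved here in both coordinate systems of the tree, for every dimension `d`, every compact group and every
continuous unitary matrix representation `ρ`:

* `integral_mul_timeReflect_nonneg_odd` — real form of the tree's `wilsonExpectation_oddReflectionPositive` (odd side
  `L ≥ 3`, reflection `θ t = 1 − t`, observables of `oPosEdges ∪ oSharedEdges`);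
* `sq_integral_mul_timeReflect_le_odd` — the Schwarz inequality `(∫ A·B∘Θ)² ≤ (∫ A·A∘Θ)(∫ B·B∘Θ)` for such observables
  (the tree's abstract `MultiReflection.sq_integral_mul_comp_le_of_rp`);
* `sq_cov_timeReflect_le_odd` — its TRUNCATED form `Cov(A, B∘Θ)² ≤ Cov(A, A∘Θ) · Cov(B, B∘Θ)` (constants are
  reflection-invariant and admissible);
* `sq_cov_negReflect_le_odd` — the same in the SITE-reflection coordinates `ϑ t = −t` of side `2S+1` (`GaugeConfig.negReflect`,
  fixed slice `t = 0`), for observables of the half `negSideEdges S ∪ sliceZeroEdges` (times `S+1 … 2S` and the spatial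
  links of the slice `t = 0`), transported along the translation `t ↦ t − S` exactly as the tree's
  `wilsonExpectation_nonneg_of_negCovariant`.

Refs: Osterwalder–Seiler 1978 §2; Fröhlich–Israel–Lieb–Simon 1978 Thm 2.1 (Schwarz inequality from RP); the card cited
above for the intended use (`Cov(W, Ṽ)² ≤ Var-type(W) · Cov(Ṽ∘ϑ, Ṽ)` with `W` on the `ϑ`-fixed slice).
-/

set_option autoImplicit false

noncomputable section

open MeasureTheory Finset
open Literature.MathematicalPhysics.QuantumFieldTheory
open Literature.MathematicalPhysics.QuantumFieldTheory.WilsonRP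
open Literature.MathematicalPhysics.QuantumFieldTheory.WilsonOddRP
open Literature.MathematicalPhysics.QuantumFieldTheory.WilsonNegRP
open Literature.MathematicalPhysics.QuantumFieldTheory.FariaDaVeigaOCarroll2022
open Literature.MathematicalPhysics.QuantumFieldTheory.FariaDaVeigaOCarroll2022.MultiReflection

namespace Summit.QuantumFields.YangMills.Cruxes.NT.Reflection

section Odd

variable {d L N : ℕ} [NeZero d] [NeZero L]
variable {G : Type*} [Group G] [TopologicalSpace G] [IsTopologicalGroup G] [CompactSpace G]
  [MeasurableSpace G] [BorelSpace G] (ρ : G →* Matrix (Fin N) (Fin N) ℂ)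

/-- **Reflection positivity on the odd torus, real form.**  For a bounded measurable REAL observable `F` of the links
`oPosEdges ∪ oSharedEdges` (positive block `1 ≤ t ≤ L/2` and the shared spatial slice `t = L/2 + 1`) of the odd torus
of side `L ≥ 3`: `0 ≤ ∫ F · F∘Θ dμ_{Λ,β}` (`β ≥ 0`).  Real form of the tree's `wilsonExpectation_oddReflectionPositive`.
[cite: OsterwalderSeiler1978, §2] -/
theorem integral_mul_timeReflect_nonneg_odd (hL : Odd L) (hL3 : 3 ≤ L) (hρ : Continuous ρ) {β : ℝ} (hβ : 0 ≤ β)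
    {F : GaugeConfig d L G → ℝ} (hFm : Measurable F) (hFb : ∃ K : ℝ, ∀ U, |F U| ≤ K)
    (hFdep : DependsOn F ((oPosEdges ∪ oSharedEdges : Finset (Edge d L)) : Set (Edge d L))) :
    0 ≤ ∫ U, F U * F U.timeReflect ∂(wilsonMeasure ρ β) := by
  obtain ⟨K, hK⟩ := hFb
  have hdep : DependsOn (fun U : GaugeConfig d L G => (F U : ℂ))
      ((oPosEdges ∪ oSharedEdges : Finset (Edge d L)) : Set (Edge d L)) := by
    intro U V hUV
    simp only [Complex.ofReal_inj]
    exact hFdep hUV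
  have h := wilsonExpectation_oddReflectionPositive ρ hL hL3 hρ hβ (fun U => (F U : ℂ))
    (Complex.measurable_ofReal.comp hFm) ⟨K, fun U => by rw [Complex.norm_real, Real.norm_eq_abs]; exact hK U⟩ hdep
  unfold wilsonExpectation at h
  have h' : (∫ U, (starRingEnd ℂ) ((F U.timeReflect : ℝ) : ℂ) * (F U : ℂ) ∂wilsonMeasure ρ β) =
      ((∫ U, F U * F U.timeReflect ∂wilsonMeasure ρ β : ℝ) : ℂ) := by
    rw [← integral_complex_ofReal]
    refine integral_congr_ae (ae_of_all _ fun U => ?_)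
    simp only [Complex.conj_ofReal]
    push_cast
    ring
  rw [h'] at h
  exact Complex.zero_le_real.1 h

/-- **Schwarz inequality from reflection positivity, odd torus, link reflection.**  For bounded measurable real
observables `A, B` of `oPosEdges ∪ oSharedEdges`: `(∫ A · B∘Θ)² ≤ (∫ A · A∘Θ) · (∫ B · B∘Θ)` (the tree's abstract
`sq_integral_mul_comp_le_of_rp` with the class of such observables, which is closed under `A + t B`).
[cite: FrohlichIsraelLiebSimon1978, Thm. 2.1] -/
theorem sq_integral_mul_timeReflect_le_odd (hL : Odd L) (hL3 : 3 ≤ L) (hρ : Continuous ρ) {β : ℝ} (hβ : 0 ≤ β)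
    {A B : GaugeConfig d L G → ℝ} (hAm : Measurable A) (hBm : Measurable B)
    (hAb : ∃ K : ℝ, ∀ U, |A U| ≤ K) (hBb : ∃ K : ℝ, ∀ U, |B U| ≤ K)
    (hAdep : DependsOn A ((oPosEdges ∪ oSharedEdges : Finset (Edge d L)) : Set (Edge d L)))
    (hBdep : DependsOn B ((oPosEdges ∪ oSharedEdges : Finset (Edge d L)) : Set (Edge d L))) :
    (∫ U, A U * B U.timeReflect ∂(wilsonMeasure ρ β)) ^ 2 ≤
      (∫ U, A U * A U.timeReflect ∂(wilsonMeasure ρ β)) * (∫ U, B U * B U.timeReflect ∂(wilsonMeasure ρ β)) := by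
  haveI := isProbabilityMeasure_wilsonMeasure (d := d) (L := L) ρ hρ β
  -- `Θ` is an involution (the tree's `SoloBlind.timeReflect_timeReflect_config`, inlined to keep the imports light)
  have hΘΘ : ∀ U : GaugeConfig d L G, U.timeReflect.timeReflect = U := fun U => by
    funext e
    have h2 : (edgeReflect e).2 = e.2 := by
      unfold edgeReflect; split_ifs with h <;> simp [h]
    rw [timeReflect_apply, timeReflect_apply, h2, edgeReflect_edgeReflect]
    split_ifs <;> simp
  have key := sq_integral_mul_comp_le_of_rp (μ := wilsonMeasure (d := d) (L := L) ρ β)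
    (timeReflectEquiv (d := d) (L := L) (G := G)) (measurePreserving_timeReflectEquiv ρ hρ β)
    (fun U => hΘΘ U)
    (fun F => DependsOn F ((oPosEdges ∪ oSharedEdges : Finset (Edge d L)) : Set (Edge d L)))
    (fun A' B' t hA' hB' => fun U V hUV => by simp only; rw [hA' hUV, hB' hUV])
    (fun F hF hFm hFb => integral_mul_timeReflect_nonneg_odd ρ hL hL3 hρ hβ hFm hFb hF)
    hAdep hBdep hAm hBm hAb hBb
  exact key

omit [NeZero d] in
/-- Bounded measurable real observables are integrable for the Wilson measure. [folklore] -/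
theorem integrable_wilson_of_bdd (hρ : Continuous ρ) (β : ℝ) {A : GaugeConfig d L G → ℝ} (hAm : Measurable A)
    (hAb : ∃ K : ℝ, ∀ U, |A U| ≤ K) : Integrable A (wilsonMeasure ρ β) := by
  haveI := isProbabilityMeasure_wilsonMeasure (d := d) (L := L) ρ hρ β
  obtain ⟨K, hK⟩ := hAb
  exact Integrable.of_bound hAm.aestronglyMeasurable K (ae_of_all _ fun U => by rw [Real.norm_eq_abs]; exact hK U)

/-- Centring identity: `∫ (A − a)(B∘Θ − b) = ∫ A · B∘Θ − a b` for `a = ∫ A`, `b = ∫ B` (`Θ` measure preserving).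
[folklore] -/
theorem integral_centred_mul_timeReflect (hρ : Continuous ρ) (β : ℝ) {A B : GaugeConfig d L G → ℝ}
    (hAm : Measurable A) (hBm : Measurable B) (hAb : ∃ K : ℝ, ∀ U, |A U| ≤ K) (hBb : ∃ K : ℝ, ∀ U, |B U| ≤ K) :
    ∫ U, (A U - ∫ V, A V ∂(wilsonMeasure ρ β)) * (B U.timeReflect - ∫ V, B V ∂(wilsonMeasure ρ β))
        ∂(wilsonMeasure ρ β) =
      ∫ U, A U * B U.timeReflect ∂(wilsonMeasure ρ β) -
        (∫ V, A V ∂(wilsonMeasure ρ β)) * (∫ V, B V ∂(wilsonMeasure ρ β)) := by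
  haveI := isProbabilityMeasure_wilsonMeasure (d := d) (L := L) ρ hρ β
  set μ := wilsonMeasure (d := d) (L := L) ρ β with hμ
  set a := ∫ V, A V ∂μ
  set b := ∫ V, B V ∂μ
  obtain ⟨KA, hKA⟩ := hAb
  obtain ⟨KB, hKB⟩ := hBb
  have hΘm : Measurable (GaugeConfig.timeReflect : GaugeConfig d L G → GaugeConfig d L G) := measurable_timeReflect
  have iA : Integrable A μ := integrable_wilson_of_bdd ρ hρ β hAm ⟨KA, hKA⟩
  have iBΘ : Integrable (fun U => B U.timeReflect) μ :=
    integrable_wilson_of_bdd ρ hρ β (hBm.comp hΘm) ⟨KB, fun U => hKB _⟩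
  have iABΘ : Integrable (fun U => A U * B U.timeReflect) μ :=
    integrable_wilson_of_bdd ρ hρ β (hAm.mul (hBm.comp hΘm)) ⟨KA * KB, fun U => by
      rw [abs_mul]; exact mul_le_mul (hKA U) (hKB _) (abs_nonneg _) ((abs_nonneg _).trans (hKA U))⟩
  -- `∫ B∘Θ = ∫ B`
  have hBΘ : ∫ U, B U.timeReflect ∂μ = b := by
    have h := (measurePreserving_timeReflectEquiv (d := d) (L := L) (G := G) ρ hρ β).integral_comp
      (timeReflectEquiv (d := d) (L := L) (G := G)).measurableEmbedding B
    exact h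
  have hexp : (fun U => (A U - a) * (B U.timeReflect - b)) =
      fun U => (A U * B U.timeReflect - b * A U) - (a * B U.timeReflect - a * b) := by
    funext U; ring
  have i1 : Integrable (fun U => A U * B U.timeReflect - b * A U) μ := iABΘ.sub (iA.const_mul b)
  have i2 : Integrable (fun U => a * B U.timeReflect - a * b) μ := (iBΘ.const_mul a).sub (integrable_const _)
  have i3 : Integrable (fun U => b * A U) μ := iA.const_mul b
  have i4 : Integrable (fun U => a * B U.timeReflect) μ := iBΘ.const_mul a
  have i5 : Integrable (fun _ : GaugeConfig d L G => a * b) μ := integrable_const _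
  rw [hexp, integral_sub i1 i2, integral_sub iABΘ i3, integral_sub i4 i5, integral_const_mul, integral_const_mul,
    hBΘ, integral_const]
  have ha : ∫ V, A V ∂μ = a := rfl
  rw [ha, smul_eq_mul, probReal_univ]
  ring

/-- **Truncated Schwarz inequality from reflection positivity, odd torus, link reflection.**  For bounded measurable
real observables `A, B` of `oPosEdges ∪ oSharedEdges`:
`(∫ A·B∘Θ − ∫A ∫B)² ≤ (∫ A·A∘Θ − (∫A)²) · (∫ B·B∘Θ − (∫B)²)` — the covariance form (constants are admissible and
`Θ`-invariant, so the centred observables are admissible). [cite: FrohlichIsraelLiebSimon1978, Thm. 2.1] -/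
theorem sq_cov_timeReflect_le_odd (hL : Odd L) (hL3 : 3 ≤ L) (hρ : Continuous ρ) {β : ℝ} (hβ : 0 ≤ β)
    {A B : GaugeConfig d L G → ℝ} (hAm : Measurable A) (hBm : Measurable B)
    (hAb : ∃ K : ℝ, ∀ U, |A U| ≤ K) (hBb : ∃ K : ℝ, ∀ U, |B U| ≤ K)
    (hAdep : DependsOn A ((oPosEdges ∪ oSharedEdges : Finset (Edge d L)) : Set (Edge d L)))
    (hBdep : DependsOn B ((oPosEdges ∪ oSharedEdges : Finset (Edge d L)) : Set (Edge d L))) :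
    (∫ U, A U * B U.timeReflect ∂(wilsonMeasure ρ β) -
        (∫ U, A U ∂(wilsonMeasure ρ β)) * (∫ U, B U ∂(wilsonMeasure ρ β))) ^ 2 ≤
      (∫ U, A U * A U.timeReflect ∂(wilsonMeasure ρ β) - (∫ U, A U ∂(wilsonMeasure ρ β)) ^ 2) *
        (∫ U, B U * B U.timeReflect ∂(wilsonMeasure ρ β) - (∫ U, B U ∂(wilsonMeasure ρ β)) ^ 2) := by
  set μ := wilsonMeasure (d := d) (L := L) ρ β with hμ
  set a := ∫ U, A U ∂μ
  set b := ∫ U, B U ∂μ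
  obtain ⟨KA, hKA⟩ := hAb
  obtain ⟨KB, hKB⟩ := hBb
  -- the centred observables are admissible
  have hA'm : Measurable fun U => A U - a := hAm.sub measurable_const
  have hB'm : Measurable fun U => B U - b := hBm.sub measurable_const
  have hA'b : ∃ K : ℝ, ∀ U, |A U - a| ≤ K := ⟨KA + |a|, fun U => (abs_sub _ _).trans (by linarith [hKA U])⟩
  have hB'b : ∃ K : ℝ, ∀ U, |B U - b| ≤ K := ⟨KB + |b|, fun U => (abs_sub _ _).trans (by linarith [hKB U])⟩
  have hA'dep : DependsOn (fun U => A U - a) ((oPosEdges ∪ oSharedEdges : Finset (Edge d L)) : Set (Edge d L)) :=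
    fun U V hUV => by simp only; rw [hAdep hUV]
  have hB'dep : DependsOn (fun U => B U - b) ((oPosEdges ∪ oSharedEdges : Finset (Edge d L)) : Set (Edge d L)) :=
    fun U V hUV => by simp only; rw [hBdep hUV]
  have key := sq_integral_mul_timeReflect_le_odd ρ hL hL3 hρ hβ hA'm hB'm hA'b hB'b hA'dep hB'dep
  have eAB := integral_centred_mul_timeReflect ρ hρ β hAm hBm ⟨KA, hKA⟩ ⟨KB, hKB⟩
  have eAA := integral_centred_mul_timeReflect ρ hρ β hAm hAm ⟨KA, hKA⟩ ⟨KA, hKA⟩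
  have eBB := integral_centred_mul_timeReflect ρ hρ β hBm hBm ⟨KB, hKB⟩ ⟨KB, hKB⟩
  beta_reduce at key
  rw [eAB, eAA, eBB] at key
  simpa only [sq] using key

end Odd

/-! ## Site-reflection coordinates `ϑ t = −t` (side `2S+1`): the transport along `t ↦ t − S` -/

section Neg

variable {d L N : ℕ} [NeZero d] [NeZero L]
variable {G : Type*} [Group G] [TopologicalSpace G] [IsTopologicalGroup G] [CompactSpace G]
  [MeasurableSpace G] [BorelSpace G] (ρ : G →* Matrix (Fin N) (Fin N) ℂ)

omit [Group G] [TopologicalSpace G] [IsTopologicalGroup G] [CompactSpace G] [BorelSpace G] in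
/-- An observable of the half `negSideEdges S ∪ sliceZeroEdges` (times `S+1 … 2S`, spatial slice `t = 0`), read through
the translation `t ↦ t − S`, is an observable of `oPosEdges ∪ oSharedEdges`. [folklore] -/
theorem dependsOn_comp_shift_of_negSide {S : ℕ} (hL : L = 2 * S + 1) (hS : 1 ≤ S) {A : GaugeConfig d L G → ℝ}
    (hA : DependsOn A ((negSideEdges S ∪ sliceZeroEdges : Finset (Edge d L)) : Set (Edge d L))) :
    DependsOn (A ∘ torusConfigShift (shiftVec S))
      ((oPosEdges ∪ oSharedEdges : Finset (Edge d L)) : Set (Edge d L)) := by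
  intro U' V' hUV
  simp only [Function.comp_apply]
  refine hA fun e he => ?_
  rw [torusConfigShift_apply, torusConfigShift_apply]
  refine hUV _ (mem_coe.2 ?_)
  have he' := mem_coe.1 he
  simp only [mem_union, negSideEdges, sliceZeroEdges, mem_filter, mem_univ, true_and] at he'
  simp only [mem_union, mem_oPosEdges, mem_oSharedEdges, IsOPosEdge, IsOSharedEdge]
  rw [sub_shiftVec_apply_zero]
  rcases he' with h | ⟨h2, h0⟩
  · exact Or.inl (val_sub_of_negSide hL h)
  · exact Or.inr ⟨h2, val_sub_of_zero hL hS h0⟩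

/-- **Truncated Schwarz inequality from reflection positivity, odd torus, SITE reflection `ϑ t = −t`.**  On the torus
of side `L = 2S+1` (`S ≥ 1`, `β ≥ 0`), for bounded measurable real observables `A, B` of the half
`negSideEdges S ∪ sliceZeroEdges`:
`(∫ A·B∘ϑ − ∫A ∫B)² ≤ (∫ A·A∘ϑ − (∫A)²) · (∫ B·B∘ϑ − (∫B)²)`, `ϑ = GaugeConfig.negReflect`.  In particular for `B`
living on the `ϑ`-FIXED slice links (`B∘ϑ = B`) the right factor is `Var B` — the card's «RPCS».  Transport of
`sq_cov_timeReflect_le_odd` along the translation `t ↦ t − S` (`negReflect_torusConfigShift`,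
`wilsonExpectation_comp_torusConfigShift`). [cite: OsterwalderSeiler1978, §2] -/
theorem sq_cov_negReflect_le_odd {S : ℕ} (hL : L = 2 * S + 1) (hS : 1 ≤ S) (hρ : Continuous ρ) {β : ℝ}
    (hβ : 0 ≤ β) {A B : GaugeConfig d L G → ℝ} (hAm : Measurable A) (hBm : Measurable B)
    (hAb : ∃ K : ℝ, ∀ U, |A U| ≤ K) (hBb : ∃ K : ℝ, ∀ U, |B U| ≤ K)
    (hAdep : DependsOn A ((negSideEdges S ∪ sliceZeroEdges : Finset (Edge d L)) : Set (Edge d L)))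
    (hBdep : DependsOn B ((negSideEdges S ∪ sliceZeroEdges : Finset (Edge d L)) : Set (Edge d L))) :
    (∫ U, A U * B U.negReflect ∂(wilsonMeasure ρ β) -
        (∫ U, A U ∂(wilsonMeasure ρ β)) * (∫ U, B U ∂(wilsonMeasure ρ β))) ^ 2 ≤
      (∫ U, A U * A U.negReflect ∂(wilsonMeasure ρ β) - (∫ U, A U ∂(wilsonMeasure ρ β)) ^ 2) *
        (∫ U, B U * B U.negReflect ∂(wilsonMeasure ρ β) - (∫ U, B U ∂(wilsonMeasure ρ β)) ^ 2) := by
  have hodd : Odd L := ⟨S, hL⟩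
  have hL3 : 3 ≤ L := by omega
  set τ := torusConfigShift (G := G) (shiftVec (d := d) (L := L) S) with hτ
  have hτm : Measurable τ := (torusConfigShift (G := G) (shiftVec (d := d) (L := L) S)).measurable
  -- every integral is invariant under the translation
  have hshift : ∀ Φ : GaugeConfig d L G → ℝ, ∫ U, Φ U ∂(wilsonMeasure ρ β) = ∫ U, Φ (τ U) ∂(wilsonMeasure ρ β) := by
    intro Φ
    have h := wilsonExpectation_comp_torusConfigShift ρ β (shiftVec (d := d) (L := L) S) Φ
    unfold wilsonExpectation at h
    exact h.symm
  -- the translation conjugates `ϑ` to `Θ`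
  have hconj : ∀ (Φ Ψ : GaugeConfig d L G → ℝ),
      ∫ U, Φ U * Ψ U.negReflect ∂(wilsonMeasure ρ β) = ∫ U, (Φ ∘ τ) U * (Ψ ∘ τ) U.timeReflect ∂(wilsonMeasure ρ β) := by
    intro Φ Ψ
    rw [hshift (fun U => Φ U * Ψ U.negReflect)]
    refine integral_congr_ae (ae_of_all _ fun U => ?_)
    simp only [Function.comp_apply, hτ, negReflect_torusConfigShift hL]
  rw [hconj A B, hconj A A, hconj B B, hshift A, hshift B]
  exact sq_cov_timeReflect_le_odd ρ hodd hL3 hρ hβ (hAm.comp hτm) (hBm.comp hτm)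
    (hAb.imp fun K hK U => hK _) (hBb.imp fun K hK U => hK _)
    (dependsOn_comp_shift_of_negSide hL hS hAdep) (dependsOn_comp_shift_of_negSide hL hS hBdep)

end Neg

end Summit.QuantumFields.YangMills.Cruxes.NT.Reflection

end
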